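import Literature.Analysis.FluidPDE.PassiveVectorEnergyEquality
import Summits.AnomalousDissipation.AnomalousDissipation.Theorems.SolenoidalFractalHomogenisationLagrangianStepDefs
import Summits.AnomalousDissipation.AnomalousDissipation.Theorems.SolenoidalFractalHomogenisationLagrangianRenormalisationStepExistsL
import Summits.AnomalousDissipation.AnomalousDissipation.Theorems.SolenoidalFractalHomogenisationProjectedRenormalisationStepDefs
import HarnessLib

/-!
# K1 `ProjectedRenormalisationStep` (stmt-AnomalousDissipation-19071): registered stub `stub_energy` — the energy inequality
# past time `1/2` for weak solutions of the full problem along a `Regular` fractal shear carrier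

Helper file of route `SolenoidalFractalHomogenisation` (`--supports stmt-AnomalousDissipation-19071`; registered birth skeleton sha
`e2b567d2f478eabc…`; shared vocabulary `…ProjectedRenormalisationStepDefs`).  `stub_energy` (text verbatim): for a `Regular` fractal
shear carrier `D`, every index `j`, admissible datum `w₀` and weak solution `w` of the FULL problem (`FullSol D j w₀ w`: carrier
`D.carrier`, viscosity `D.kbar j`), for a.e. `t ∈ (1/2, 1)`: `‖w(t)‖² + 2·(kbar j)∫₀^{1/2}‖∇w‖² ≤ ‖w₀‖²` (in `[0,∞]`).
Proof: `Regular` ⇒ the carrier is `C⁰_t C^{0,α}_x`, hence essentially bounded on `(0,1) × 𝕋³`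
(joint continuity of `C⁰_t C^{0,α}_x` families + `LagrangianRenormalisationStep.memLp_top_stLift_of_continuous`); the energy EQUALITY for A0 weak solutions with bounded carrier
(`IsWeakPassiveVectorOn.ae_energy_eq`) and monotonicity of the dissipation in the horizon.
ASIDE item; generic A0 infrastructure, NOT a proof of the crux nor of anomalous dissipation.  Rung F-D1.A0.
Prover seat `leafhand-ad-solenoidalfractalh-1` g0.
-/

set_option linter.dupNamespace false

noncomputable section

namespace Summit.AnomalousDissipation.AnomalousDissipation.Theorems.SolenoidalFractalHomogenisation.ProjectedRenormalisationStep

open Literature.Analysis Literature.Analysis.FluidPDE Literature.Analysis.FunctionSpaces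
open MeasureTheory Set Filter Function Topology
open scoped ENNReal NNReal
open Literature.Analysis.FluidPDE.Torus (eVectorDissipation vectorL2Sq)
open Summit.AnomalousDissipation.AnomalousDissipation.Theorems.SolenoidalFractalHomogenisation.LagrangianStep (IsDatum InClass)
open Summit.AnomalousDissipation.AnomalousDissipation.Theorems.SolenoidalFractalHomogenisation.LagrangianRenormalisationStep
  (memLp_top_stLift_of_continuous)
open Summit.AnomalousDissipation.AnomalousDissipation.Theorems.SolenoidalFractalHomogenisation.RealisedQuasiStaticCellLaw
  (memLp_two_of_memSobolev_one_complexify)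


variable {k : ℕ}

/-- A `C⁰_t C^{0,α}_x` family (`α > 0`) on all of `ℝ` is jointly continuous on `ℝ × T³` (route-independent private copy of
`CascadeBookkeeping.continuous_uncurry_of_continuousInHolderOn`, whose module imports the route file). [folklore] -/
private theorem continuous_uncurry_of_continuousInHolderOn {α : ℝ≥0} (hα : 0 < α)
    {b : ℝ → UnitAddTorus (Fin 3) → EuclideanSpace ℝ (Fin 3)} (hb : ContinuousInHolderOn univ α b) :
    Continuous (uncurry b) := by
  rw [continuous_iff_continuousAt]
  rintro ⟨t₀, x₀⟩
  have hslice : Continuous (b t₀) := (hb.1 t₀ (mem_univ _)).continuous hα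
  have h1 : Tendsto (fun p : ℝ × UnitAddTorus (Fin 3) => eBoundedHolderNorm α (b p.1 - b t₀)) (𝓝 (t₀, x₀)) (𝓝 0) := by
    have h := hb.2 t₀ (mem_univ _)
    rw [nhdsWithin_univ] at h
    exact h.comp (continuous_fst.tendsto (t₀, x₀))
  have h2 : Tendsto (fun p : ℝ × UnitAddTorus (Fin 3) => ‖b t₀ p.2 - b t₀ x₀‖ₑ) (𝓝 (t₀, x₀)) (𝓝 0) := by
    have hc : Continuous fun p : ℝ × UnitAddTorus (Fin 3) => b t₀ p.2 - b t₀ x₀ :=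
      (hslice.comp continuous_snd).sub continuous_const
    have := hc.enorm.tendsto (t₀, x₀)
    simpa using this
  have h12 : Tendsto (fun p : ℝ × UnitAddTorus (Fin 3) =>
      eBoundedHolderNorm α (b p.1 - b t₀) + ‖b t₀ p.2 - b t₀ x₀‖ₑ) (𝓝 (t₀, x₀)) (𝓝 0) := by
    simpa using h1.add h2
  rw [ContinuousAt, tendsto_iff_edist_tendsto_0]
  refine tendsto_of_tendsto_of_tendsto_of_le_of_le tendsto_const_nhds h12 (fun p => zero_le) (fun p => ?_)
  calc edist (uncurry b p) (uncurry b (t₀, x₀)) = ‖(b p.1 - b t₀) p.2 + (b t₀ p.2 - b t₀ x₀)‖ₑ := by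
        rw [edist_eq_enorm_sub]
        congr 1
        simp only [uncurry, Pi.sub_apply]
        abel
    _ ≤ ‖(b p.1 - b t₀) p.2‖ₑ + ‖b t₀ p.2 - b t₀ x₀‖ₑ := enorm_add_le _ _
    _ ≤ eBoundedHolderNorm α (b p.1 - b t₀) + ‖b t₀ p.2 - b t₀ x₀‖ₑ := by
        gcongr
        exact (enorm_le_eSupNorm _ _).trans (eSupNorm_le_eBoundedHolderNorm _ _)

/-- The dissipation `ν∫ₐᵇ‖∇w‖²` is monotone in the right endpoint. [folklore] -/
theorem eVectorDissipation_mono_right (ν : ℝ) (w : ℝ → UnitAddTorus (Fin 3) → EuclideanSpace ℝ (Fin 3)) (a : ℝ) {b b' : ℝ}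
    (h : b ≤ b') : eVectorDissipation ν w a b ≤ eVectorDissipation ν w a b' := by
  unfold Torus.eVectorDissipation
  exact mul_le_mul_right (lintegral_mono_set (Ioo_subset_Ioo le_rfl h)) _

/-- **Registered stub `stub_energy` (K1 skeleton e2b567d2, text verbatim): the energy inequality past time `1/2` for
every weak solution of the FULL problem along a `Regular` fractal shear carrier.**  `Regular` makes the carrier
`C⁰_t C^{0,α}_x`, hence essentially bounded on `(0,1) × 𝕋³`; the energy EQUALITY for A0 weak solutions with bounded
carrier (`IsWeakPassiveVectorOn.ae_energy_eq`, Lions–Magenes) gives `‖w(t)‖² + 2ν∫₀ᵗ‖∇w‖² = ‖w₀‖²` for a.e. `t ∈ (0,1)`,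
and `∫₀^{1/2} ≤ ∫₀ᵗ` for `t > 1/2`. [cite: Temam1984, Ch. III §1 Lemma 1.2] -/
theorem stub_energy : ∀ k (D : LatticeShear.FractalCarrierData k), D.Regular → ∀ (j : ℕ) (w₀ : UnitAddTorus (Fin 3) → EuclideanSpace ℝ (Fin 3))
    (w : ℝ → UnitAddTorus (Fin 3) → EuclideanSpace ℝ (Fin 3)), IsDatum w₀ → FullSol D j w₀ w →
    ∀ᵐ t ∂(volume.restrict (Ioo (1 / 2 : ℝ) 1)),
      ENNReal.ofReal (∫ x, ‖w t x‖ ^ 2) + 2 * Torus.eVectorDissipation (D.kbar j) w 0 (1 / 2) ≤ ENNReal.ofReal (Torus.vectorL2Sq w₀) := by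
  intro k D hR j w₀ w hw₀ hw
  obtain ⟨-, α, hα, hHolder, -, -⟩ := hR
  have hb := memLp_top_stLift_of_continuous (continuous_uncurry_of_continuousInHolderOn hα hHolder) 1
  have hw₀2 : MemLp w₀ 2 volume := memLp_two_of_memSobolev_one_complexify hw₀.1
  have hE := Torus.IsWeakPassiveVectorOn.ae_energy_eq hw (D.kbar_pos j) hw₀2 hw₀.2.2 hb
  have hE' : ∀ᵐ t ∂(volume.restrict (Ioo (1 / 2 : ℝ) 1)),
      ENNReal.ofReal (∫ x, ‖w t x‖ ^ 2) + 2 * eVectorDissipation (D.kbar j) w 0 t = ENNReal.ofReal (∫ x, ‖w₀ x‖ ^ 2) :=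
    ae_restrict_of_ae_restrict_of_subset (Ioo_subset_Ioo (by norm_num) le_rfl) hE
  filter_upwards [hE', ae_restrict_mem measurableSet_Ioo] with t ht htI
  calc ENNReal.ofReal (∫ x, ‖w t x‖ ^ 2) + 2 * eVectorDissipation (D.kbar j) w 0 (1 / 2)
      ≤ ENNReal.ofReal (∫ x, ‖w t x‖ ^ 2) + 2 * eVectorDissipation (D.kbar j) w 0 t :=
        add_le_add le_rfl (mul_le_mul_right (eVectorDissipation_mono_right _ w 0 htI.1.le) 2)
    _ = ENNReal.ofReal (∫ x, ‖w₀ x‖ ^ 2) := ht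
    _ = ENNReal.ofReal (vectorL2Sq w₀) := rfl

end Summit.AnomalousDissipation.AnomalousDissipation.Theorems.SolenoidalFractalHomogenisation.ProjectedRenormalisationStep

end
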